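import Summits.HodgeConjecture.HodgeConjecture.Theorems.F0P3cStCharTSTorusChartIso     -- ★ `torusChartEquiv : E_vˣ × E¹_v ≃ₜ* M`, `torusCoords`, `torusChart_torusCoords` (split torus of `U(Φ₃)(L⁺_v)`)
import Summits.HodgeConjecture.HodgeConjecture.Theorems.F0P3cStCharTSTorusCompactPart  -- ★ `compactSpace_normOneUnits` (`E¹_v` compact at a non-split place)
import Summits.HodgeConjecture.HodgeConjecture.Theorems.F0P3cStCharTSEllCartanCompact -- ★ `exists_conj_cmTorus_of_not_isCompact_centralizer` (a non-compact Cartan is conjugate to `M`)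
import Literature.NumberTheory.Automorphic.AdicCompletionCompact                      -- ★ `properSpace_adicCompletion` (closed balls of `L_w` are compact)
import HarnessLib

/-!
# F0 · P3c · ROAD «UP-TR» brick (A0-iv) «SUPPORT COMPACTNESS ON THE SPLIT TORUS»: the elements of the split torus `M ⊂ G = U(Φ₃)(L⁺_v)` that have a
# conjugate in a fixed compact set form a RELATIVELY COMPACT subset of `M` (Harish-Chandra 1970 L. 42 context; Rogawski 1990 §12.5 p. 183)

Cell `pub/hodgecm-mathlib`, crux H413 = `stmt-HodgeConjecture-24833` (lane `--supports`, helper); seat LH1-p01 (g13); ROAD «UP-TR» (holder ∕ dealer F0P3-p02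
(g23)), gap (A0-iv) flagged 2026-09-02T19:13:41Z: the locally-bounded antecedent of `UpSpecLB` («`‖D_H(s) α(s)‖ ≤ B` for `s` in a COMPACT set») meets the NON-COMPACT
Cartan `M_H ≅ E_vˣ × E¹_v` in the assembly (A-3); what makes it applicable is that the torus-side integrand at `t` carries the orbital integral `Φ_G([t], f)`, which
vanishes unless `t` has a conjugate in `tsupport f` — and THOSE `t` stay in a compact part of the torus.  THEOREMS ONLY; sorry-free; no definition ∕ instance ∕
notation ∕ named fact; ★-only imports; axioms TRIO.

THE STATEMENT (§4 `exists_isCompact_forall_conj_mem_cmBorelM`).  `v` non-split, `G = U(Φ₃)(L⁺_v)` on the ★ `cmLocalForm` carrier, `M = (cmBorelTriple L 3 v).M` its diagonal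
torus.  For every compact `C ⊆ G` there is a compact `K ⊆ ↥M` with `{t ∈ M | ∃ x ∈ G, x t x⁻¹ ∈ C} ⊆ K`.

THE PROOF (no characteristic polynomials, no valuations: one eigenvector).  Read everything at the place `w ∣ v` in `GL₃(L_w)` (entrywise evaluation `ψ_w`, a continuous
monoid hom).  On the compact `ψ_w(C)` the entries of `g` and of `g⁻¹` are bounded, say `Σ_{k,j} ‖g_{kj}‖ + ‖(g⁻¹)_{kj}‖ ≤ R` (§3).  If `g = x · diag(d) · x⁻¹` then
`v := x e_i ≠ 0` is an eigenvector, `g v = d_i v` (§2), so `‖d_i‖ ≤ Σ_{k,j} ‖g_{kj}‖ ≤ R` (§1: `‖d_i‖ ‖v‖_∞ = ‖g v‖_∞ ≤ (Σ‖g_{kj}‖) ‖v‖_∞`), and the same with `g⁻¹ =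
x · diag(d)⁻¹ · x⁻¹` bounds `‖d_i⁻¹‖ ≤ R`.  Hence the first chart coordinate `t₀₀ ∈ E_vˣ` of such a `t` (★ `torusCoords`) lies in `{u | ‖u‖ ≤ R, ‖u⁻¹‖ ≤ R}`, which is
compact in `E_vˣ` (closed balls of `E_v = Π_{w∣v} L_w` are compact, ★ `properSpace_adicCompletion`; the units carry the embedding topology `u ↦ (u, u⁻¹)`, Mathlib
`Units.isClosedEmbedding_embedProduct`); the second coordinate lives in the compact `E¹_v` (★ `compactSpace_normOneUnits`); and `t = ι(torusCoords t)` with the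
chart `ι` continuous (★ `torusChartEquiv`).

CONSUMER SHAPES (§4): the `↥M` form above; the conjugate-torus form for `T′ = y M y⁻¹` (every split Cartan `Z_G(γ)` of (A-3) is such a `T′ = ψ(M_H)`); and the
transport to any topological group `A` along `e : A' ≃ₜ* ↥T′`-type data is left to the caller (image of a compact set).  For the COMPACT Cartans the statement is
trivial (`K := univ`) and not repeated.
HONEST LABEL: count-neutral plumbing (closes no organ; block consequents 11 → 10 → 9 only at the rider editions; organs 2 = 2; h413 registry untouched); HC_CM is proved
only modulo the 7 printed citations (2 remaining named inputs: hLiu418 = `stmt-HodgeConjecture-24832`, h413 = `stmt-HodgeConjecture-24833`) until rung 0 closes.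

## References
* [HarishChandra1970] Harish-Chandra (notes by G. van Dijk), *Harmonic analysis on reductive p-adic groups*, LNM 162 (1970), Lemma 42 and its proof (orbital integrals
  of `f ∈ C_c^∞(G)` restricted to a Cartan subgroup have relatively compact support modulo the compact part).
* [Rogawski1990] J. D. Rogawski, *Automorphic Representations of Unitary Groups in Three Variables*, Ann. of Math. Stud. 123 (1990), §12.2 p. 173 (`M ≅ E* × E¹`),
  §12.5 pp. 182–183.
-/

set_option autoImplicit false
-- the mandated namespace has the single-problem summit's repeated segment (`HodgeConjecture.HodgeConjecture`)
set_option linter.dupNamespace false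

noncomputable section

open NumberField IsDedekindDomain Matrix Topology Filter
open Literature.NumberTheory.Automorphic Literature.NumberTheory.Automorphic.UnitaryGroup Literature.NumberTheory.Rogawski1990
open Summit.HodgeConjecture.HodgeConjecture.Cruxes.H413
open scoped MatrixGroups

namespace Summit.HodgeConjecture.HodgeConjecture.Cruxes.H413.F0P3cStCharTSUpTrSupportCompact

/-! ## §1 An eigenvalue is bounded by the sum of the entries (normed field, sup norm on vectors) -/

section Eigen

variable {𝕜 : Type*} [NormedField 𝕜] {n : Type*} [Fintype n]

/-- **`g v = a v`, `v ≠ 0` ⇒ `‖a‖ ≤ Σ_{k,j} ‖g_{kj}‖`**: row by row `‖a‖·‖v_k‖ = ‖Σ_j g_{kj} v_j‖ ≤ (Σ_j ‖g_{kj}‖)·‖v‖_∞`, then take the sup over `k` and cancel `‖v‖_∞ > 0`.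
[folklore] -/
theorem norm_le_sum_norm_of_mulVec_eq_smul (g : Matrix n n 𝕜) {w : n → 𝕜} (hw : w ≠ 0) {a : 𝕜} (h : g *ᵥ w = a • w) :
    ‖a‖ ≤ ∑ k, ∑ j, ‖g k j‖ := by
  have hrow : ∀ k, (∑ j, ‖g k j‖) ≤ ∑ k, ∑ j, ‖g k j‖ :=
    fun k => Finset.single_le_sum (f := fun k => ∑ j, ‖g k j‖) (fun k _ => Finset.sum_nonneg fun j _ => norm_nonneg _) (Finset.mem_univ k)
  have hpt : ∀ k, ‖a‖ * ‖w k‖ ≤ (∑ k, ∑ j, ‖g k j‖) * ‖w‖ := fun k => by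
    have hk : (∑ j, g k j * w j) = a * w k := by
      have := congrFun h k
      rwa [Matrix.mulVec, dotProduct, Pi.smul_apply, smul_eq_mul] at this
    calc ‖a‖ * ‖w k‖ = ‖∑ j, g k j * w j‖ := by rw [hk, norm_mul]
      _ ≤ ∑ j, ‖g k j * w j‖ := norm_sum_le _ _
      _ ≤ ∑ j, ‖g k j‖ * ‖w‖ := Finset.sum_le_sum fun j _ => by
          rw [norm_mul]; exact mul_le_mul_of_nonneg_left (norm_le_pi_norm w j) (norm_nonneg _)
      _ = (∑ j, ‖g k j‖) * ‖w‖ := (Finset.sum_mul _ _ _).symm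
      _ ≤ (∑ k, ∑ j, ‖g k j‖) * ‖w‖ := mul_le_mul_of_nonneg_right (hrow k) (norm_nonneg _)
  have hav : ‖a • w‖ ≤ (∑ k, ∑ j, ‖g k j‖) * ‖w‖ := by
    refine (pi_norm_le_iff_of_nonneg (mul_nonneg (Finset.sum_nonneg fun k _ => Finset.sum_nonneg fun j _ => norm_nonneg _) (norm_nonneg _))).2 fun k => ?_
    rw [Pi.smul_apply, smul_eq_mul, norm_mul]
    exact hpt k
  rw [norm_smul] at hav
  exact le_of_mul_le_mul_right hav (norm_pos_iff.2 hw)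

end Eigen

/-! ## §2 The eigenvector of a conjugated diagonal matrix (any commutative ring) -/

section Conj

variable {R : Type*} [CommRing R] {n : Type*} [Fintype n] [DecidableEq n]

/-- **`(x · diag(d) · x⁻¹) (x e_i) = d_i · (x e_i)`** for `x ∈ GL_n(R)`. [folklore] -/
theorem conj_diagonal_mulVec_eq_smul (x : GL n R) (d : n → R) (i : n) :
    ((x : Matrix n n R) * Matrix.diagonal d * ((x⁻¹ : GL n R) : Matrix n n R)) *ᵥ ((x : Matrix n n R) *ᵥ Pi.single i 1) =
      d i • ((x : Matrix n n R) *ᵥ Pi.single i 1) := by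
  have hinv : ((x⁻¹ : GL n R) : Matrix n n R) * (x : Matrix n n R) = 1 := by
    rw [← Units.val_mul, inv_mul_cancel, Units.val_one]
  rw [Matrix.mulVec_mulVec, Matrix.mul_assoc, hinv, Matrix.mul_one, ← Matrix.mulVec_mulVec, Matrix.diagonal_mulVec_single, mul_one,
    show (Pi.single i (d i) : n → R) = d i • Pi.single i 1 from by
      ext k; simp only [Pi.single_apply, Pi.smul_apply, smul_eq_mul, mul_ite, mul_one, mul_zero],
    Matrix.mulVec_smul]

/-- The vector `x e_i` is non-zero for `x ∈ GL_n(R)`, `R` non-trivial. [folklore] -/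
theorem mulVec_single_ne_zero [Nontrivial R] (x : GL n R) (i : n) : (x : Matrix n n R) *ᵥ Pi.single i 1 ≠ 0 := by
  intro h
  have hinv : ((x⁻¹ : GL n R) : Matrix n n R) * (x : Matrix n n R) = 1 := by
    rw [← Units.val_mul, inv_mul_cancel, Units.val_one]
  have h1 : (Pi.single i 1 : n → R) = ((x⁻¹ : GL n R) : Matrix n n R) *ᵥ ((x : Matrix n n R) *ᵥ Pi.single i 1) := by
    rw [Matrix.mulVec_mulVec, hinv, Matrix.one_mulVec]
  rw [h, Matrix.mulVec_zero] at h1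
  have hi := congrFun h1 i
  rw [Pi.single_eq_same, Pi.zero_apply] at hi
  exact one_ne_zero hi

end Conj

/-! ## §3 Entries and inverse entries are bounded on a compact set of `GL_n`; bounded-with-bounded-inverse units form a compact set -/

section Bounded

variable {𝕜 : Type*} [NormedField 𝕜] {n : Type*} [Fintype n] [DecidableEq n]

/-- `g ↦ Σ_{k,j} ‖g_{kj}‖ + ‖(g⁻¹)_{kj}‖` is continuous on `GL_n(𝕜)` (entries and inverse entries are continuous in the units topology). [folklore] -/
theorem continuous_sum_norm_entries :
    Continuous fun g : GL n 𝕜 => ∑ k, ∑ j, (‖(g : Matrix n n 𝕜) k j‖ + ‖((g⁻¹ : GL n 𝕜) : Matrix n n 𝕜) k j‖) := by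
  have hval : Continuous fun g : GL n 𝕜 => (g : Matrix n n 𝕜) := Units.continuous_val
  have hinv : Continuous fun g : GL n 𝕜 => ((g⁻¹ : GL n 𝕜) : Matrix n n 𝕜) := Units.continuous_coe_inv
  refine continuous_finsetSum _ fun k _ => continuous_finsetSum _ fun j _ => ?_
  exact (hval.matrix_elem k j).norm.add (hinv.matrix_elem k j).norm

/-- On a compact `C ⊆ GL_n(𝕜)` the entries of `g` and of `g⁻¹` are uniformly bounded: `Σ_{k,j} ‖g_{kj}‖ + ‖(g⁻¹)_{kj}‖ ≤ R` for `g ∈ C`. [folklore] -/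
theorem exists_sum_norm_entries_le {C : Set (GL n 𝕜)} (hC : IsCompact C) :
    ∃ R : ℝ, 0 ≤ R ∧ ∀ g ∈ C, (∑ k, ∑ j, (‖(g : Matrix n n 𝕜) k j‖ + ‖((g⁻¹ : GL n 𝕜) : Matrix n n 𝕜) k j‖)) ≤ R := by
  obtain ⟨R, hR⟩ := hC.exists_bound_of_continuousOn (continuous_sum_norm_entries.continuousOn)
  refine ⟨max R 0, le_max_right _ _, fun g hg => ?_⟩
  exact ((Real.le_norm_self _).trans (hR g hg)).trans (le_max_left _ _)

end Bounded

section UnitsCompact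

variable {A : Type*} [NormedCommRing A] [ProperSpace A]

/-- **`{u ∈ Aˣ | ‖u‖ ≤ R, ‖u⁻¹‖ ≤ R}` is compact** for a normed commutative ring `A` with compact closed balls: it is the preimage of the compact
`B̄(0,R) × op(B̄(0,R))` under the closed embedding `u ↦ (u, op u⁻¹)` (Mathlib `Units.isClosedEmbedding_embedProduct`). [folklore] -/
theorem isCompact_setOf_norm_le_norm_inv_le (R : ℝ) :
    IsCompact {u : Aˣ | ‖(u : A)‖ ≤ R ∧ ‖((u⁻¹ : Aˣ) : A)‖ ≤ R} := by
  have hK : IsCompact ((Metric.closedBall (0 : A) R) ×ˢ (MulOpposite.op '' Metric.closedBall (0 : A) R)) :=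
    (isCompact_closedBall 0 R).prod ((isCompact_closedBall 0 R).image MulOpposite.continuous_op)
  have heq : {u : Aˣ | ‖(u : A)‖ ≤ R ∧ ‖((u⁻¹ : Aˣ) : A)‖ ≤ R} =
      Units.embedProduct A ⁻¹' ((Metric.closedBall (0 : A) R) ×ˢ (MulOpposite.op '' Metric.closedBall (0 : A) R)) := by
    ext u
    simp only [Set.mem_setOf_eq, Set.mem_preimage, Units.embedProduct_apply, Set.mem_prod, Metric.mem_closedBall, dist_zero_right,
      Set.mem_image, MulOpposite.op_inj, exists_eq_right]
  rw [heq]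
  exact (Units.isClosedEmbedding_embedProduct (α := A)).isCompact_preimage hK

end UnitsCompact

/-! ## §4 `G = U(Φ₃)(L⁺_v)`: the torus elements with a conjugate in a compact set lie in a compact part of `M` -/

section CM

variable (L : Type) [Field L] [NumberField L] [IsCMField L] (v : HeightOneSpectrum (𝓞 ↥(maximalRealSubfield L)))
  (hns : ∀ w : PlacesOver L v, IsCMField.complexConj L • w.1 = w.1)

/-- Entrywise evaluation at a place `w ∣ v`, `ψ_w : G = U(Φ₃)(L⁺_v) → GL₃(L_w)`, is continuous. [folklore] -/
theorem continuous_unitsMap_eval (w : PlacesOver L v) :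
    Continuous fun g : ↥(unitaryGroupOfForm (conjLocal L (IsCMField.complexConj L) v) (cmLocalForm L 3 v)) =>
      Units.map (RingHom.mapMatrix (Pi.evalRingHom (fun w' : PlacesOver L v => w'.1.adicCompletion L) w)).toMonoidHom (g : GL (Fin 3) (LocalRing L v)) :=
  (Continuous.units_map _ (continuous_id.matrix_map (continuous_apply w))).comp continuous_subtype_val

omit [IsCMField L] in
/-- `ψ_w(diag d) = diag(d_w)` on matrices. [folklore] -/
theorem coe_unitsMap_eval_glDiagonal (w : PlacesOver L v) (d : Fin 3 → (LocalRing L v)ˣ) :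
    ((Units.map (RingHom.mapMatrix (Pi.evalRingHom (fun w' : PlacesOver L v => w'.1.adicCompletion L) w)).toMonoidHom (glDiagonal 3 (LocalRing L v) d) :
        GL (Fin 3) (w.1.adicCompletion L)) : Matrix (Fin 3) (Fin 3) (w.1.adicCompletion L)) =
      Matrix.diagonal fun i => ((d i : (LocalRing L v)ˣ) : LocalRing L v) w := by
  rw [Units.coe_map, coe_glDiagonal]
  show (Matrix.diagonal fun k => ((d k : (LocalRing L v)ˣ) : LocalRing L v)).map (Pi.evalRingHom (fun w' : PlacesOver L v => w'.1.adicCompletion L) w) = _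
  rw [Matrix.diagonal_map (map_zero _)]
  rfl

set_option maxHeartbeats 1600000 in
-- cross-spelling `whnf` on the CM carriers (`↥(unitaryGroupOfForm … (cmLocalForm L 3 v))`, `(LocalRing L v)ˣ`), measured class as ★ `F0P3cStCharTSConstants`
include hns in
/-- **(A0-iv) «SUPPORT COMPACTNESS ON THE SPLIT TORUS».**  At a non-split `v`, for the diagonal torus `M = (cmBorelTriple L 3 v).M` of `G = U(Φ₃)(L⁺_v)` and every compact
`C ⊆ G`: the elements of `M` having a `G`-conjugate in `C` lie in a compact subset of `↥M`.  (So the orbital integrals `Φ_G([t], f)`, `t ∈ M`, of a compactly supported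
`f` vanish off a compact part of the torus, and the locally-bounded antecedent of ★ `UpSpecLB` applies along `M_H ≅ M`.)  Proof: module docstring (§1–§3 + the chart
★ `torusChartEquiv`, `E¹_v` compact ★ `compactSpace_normOneUnits`, closed balls of `L_w` compact ★ `properSpace_adicCompletion`).
[cite: HarishChandra1970, Lemma 42] [cite: Rogawski1990, §12.2 p. 173; §12.5 p. 183] -/
theorem exists_isCompact_forall_conj_mem_cmBorelM {C : Set ↥(unitaryGroupOfForm (conjLocal L (IsCMField.complexConj L) v) (cmLocalForm L 3 v))} (hC : IsCompact C) :
    ∃ K : Set ↥(cmBorelTriple L 3 v).M, IsCompact K ∧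
      ∀ t : ↥(cmBorelTriple L 3 v).M, (∃ x : ↥(unitaryGroupOfForm (conjLocal L (IsCMField.complexConj L) v) (cmLocalForm L 3 v)), x * (t : ↥(unitaryGroupOfForm (conjLocal L (IsCMField.complexConj L) v) (cmLocalForm L 3 v))) * x⁻¹ ∈ C) → t ∈ K := by
  classical
  -- per place `w`: the entry bound `R w` on `ψ_w(C)`
  choose R hR0 hR using fun w : PlacesOver L v => exists_sum_norm_entries_le (hC.image (continuous_unitsMap_eval L v w))
  have hRs0 : 0 ≤ ∑ w, R w := Finset.sum_nonneg fun w _ => hR0 w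
  have hRw : ∀ w, R w ≤ ∑ w, R w := fun w => Finset.single_le_sum (f := R) (fun w _ => hR0 w) (Finset.mem_univ w)
  -- the compact set: chart image of `{‖u‖ ≤ ΣR, ‖u⁻¹‖ ≤ ΣR} × E¹_v`
  haveI : ∀ w : PlacesOver L v, ProperSpace (w.1.adicCompletion L) := fun w => properSpace_adicCompletion L w.1
  haveI : CompactSpace ↥(normOneUnits (conjLocal L (IsCMField.complexConj L) v)) := F0P3cStCharTSTorusCompactPart.compactSpace_normOneUnits L v hns
  refine ⟨(F0P3cStCharTSTorusChartIso.torusChartEquiv L v) ''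
      ({u : (LocalRing L v)ˣ | ‖(u : LocalRing L v)‖ ≤ ∑ w, R w ∧ ‖((u⁻¹ : (LocalRing L v)ˣ) : LocalRing L v)‖ ≤ ∑ w, R w} ×ˢ Set.univ),
    ((isCompact_setOf_norm_le_norm_inv_le (∑ w, R w)).prod isCompact_univ).image (F0P3cStCharTSTorusChartIso.torusChartEquiv L v).continuous, ?_⟩
  rintro t ⟨x, hx⟩
  obtain ⟨d, hd⟩ := (mem_torusU_iff _).1 t.2
  -- the eigenvalue bounds, place by place
  have hbd : ∀ w : PlacesOver L v,
      ‖((d 0 : (LocalRing L v)ˣ) : LocalRing L v) w‖ ≤ ∑ w, R w ∧ ‖(((d 0)⁻¹ : (LocalRing L v)ˣ) : LocalRing L v) w‖ ≤ ∑ w, R w := by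
    intro w
    -- `ψ_w`, `x' := ψ_w x`, `g := ψ_w (x t x⁻¹) = x' · diag(d_w) · x'⁻¹`, `g⁻¹ = x' · diag(d_w⁻¹) · x'⁻¹`
    have hg : Units.map (RingHom.mapMatrix (Pi.evalRingHom (fun w' : PlacesOver L v => w'.1.adicCompletion L) w)).toMonoidHom
        (((x * (t : ↥(unitaryGroupOfForm (conjLocal L (IsCMField.complexConj L) v) (cmLocalForm L 3 v))) * x⁻¹ : ↥(unitaryGroupOfForm (conjLocal L (IsCMField.complexConj L) v) (cmLocalForm L 3 v)))) : GL (Fin 3) (LocalRing L v)) ∈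
        (fun g : ↥(unitaryGroupOfForm (conjLocal L (IsCMField.complexConj L) v) (cmLocalForm L 3 v)) => Units.map (RingHom.mapMatrix (Pi.evalRingHom (fun w' : PlacesOver L v => w'.1.adicCompletion L) w)).toMonoidHom (g : GL (Fin 3) (LocalRing L v))) '' C :=
      ⟨_, hx, rfl⟩
    have hB := (hR w _ hg).trans (hRw w)
    have hcoe : (((x * (t : ↥(unitaryGroupOfForm (conjLocal L (IsCMField.complexConj L) v) (cmLocalForm L 3 v))) * x⁻¹ : ↥(unitaryGroupOfForm (conjLocal L (IsCMField.complexConj L) v) (cmLocalForm L 3 v)))) : GL (Fin 3) (LocalRing L v)) =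
        (x : GL (Fin 3) (LocalRing L v)) * glDiagonal 3 (LocalRing L v) d * (x : GL (Fin 3) (LocalRing L v))⁻¹ := by
      rw [Subgroup.coe_mul, Subgroup.coe_mul, Subgroup.coe_inv, hd]
    have hcoeinv : ((((x * (t : ↥(unitaryGroupOfForm (conjLocal L (IsCMField.complexConj L) v) (cmLocalForm L 3 v))) * x⁻¹ : ↥(unitaryGroupOfForm (conjLocal L (IsCMField.complexConj L) v) (cmLocalForm L 3 v)))) : GL (Fin 3) (LocalRing L v)))⁻¹ =
        (x : GL (Fin 3) (LocalRing L v)) * glDiagonal 3 (LocalRing L v) d⁻¹ * (x : GL (Fin 3) (LocalRing L v))⁻¹ := by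
      rw [hcoe, map_inv, _root_.mul_inv_rev, _root_.mul_inv_rev, inv_inv, mul_assoc]
    have hval : ((Units.map (RingHom.mapMatrix (Pi.evalRingHom (fun w' : PlacesOver L v => w'.1.adicCompletion L) w)).toMonoidHom
          (((x * (t : ↥(unitaryGroupOfForm (conjLocal L (IsCMField.complexConj L) v) (cmLocalForm L 3 v))) * x⁻¹ : ↥(unitaryGroupOfForm (conjLocal L (IsCMField.complexConj L) v) (cmLocalForm L 3 v)))) : GL (Fin 3) (LocalRing L v)) : GL (Fin 3) (w.1.adicCompletion L)) : Matrix (Fin 3) (Fin 3) (w.1.adicCompletion L)) =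
        ((Units.map (RingHom.mapMatrix (Pi.evalRingHom (fun w' : PlacesOver L v => w'.1.adicCompletion L) w)).toMonoidHom (x : GL (Fin 3) (LocalRing L v)) :
            GL (Fin 3) (w.1.adicCompletion L)) : Matrix (Fin 3) (Fin 3) (w.1.adicCompletion L)) *
          Matrix.diagonal (fun i => ((d i : (LocalRing L v)ˣ) : LocalRing L v) w) *
          (((Units.map (RingHom.mapMatrix (Pi.evalRingHom (fun w' : PlacesOver L v => w'.1.adicCompletion L) w)).toMonoidHom (x : GL (Fin 3) (LocalRing L v)))⁻¹ :
            GL (Fin 3) (w.1.adicCompletion L)) : Matrix (Fin 3) (Fin 3) (w.1.adicCompletion L)) := by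
      rw [hcoe, map_mul, map_mul, map_inv, Units.val_mul, Units.val_mul, coe_unitsMap_eval_glDiagonal]
    have hvalinv : (((Units.map (RingHom.mapMatrix (Pi.evalRingHom (fun w' : PlacesOver L v => w'.1.adicCompletion L) w)).toMonoidHom
          (((x * (t : ↥(unitaryGroupOfForm (conjLocal L (IsCMField.complexConj L) v) (cmLocalForm L 3 v))) * x⁻¹ : ↥(unitaryGroupOfForm (conjLocal L (IsCMField.complexConj L) v) (cmLocalForm L 3 v)))) : GL (Fin 3) (LocalRing L v)))⁻¹ : GL (Fin 3) (w.1.adicCompletion L)) : Matrix (Fin 3) (Fin 3) (w.1.adicCompletion L)) =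
        ((Units.map (RingHom.mapMatrix (Pi.evalRingHom (fun w' : PlacesOver L v => w'.1.adicCompletion L) w)).toMonoidHom (x : GL (Fin 3) (LocalRing L v)) :
            GL (Fin 3) (w.1.adicCompletion L)) : Matrix (Fin 3) (Fin 3) (w.1.adicCompletion L)) *
          Matrix.diagonal (fun i => (((d i)⁻¹ : (LocalRing L v)ˣ) : LocalRing L v) w) *
          (((Units.map (RingHom.mapMatrix (Pi.evalRingHom (fun w' : PlacesOver L v => w'.1.adicCompletion L) w)).toMonoidHom (x : GL (Fin 3) (LocalRing L v)))⁻¹ :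
            GL (Fin 3) (w.1.adicCompletion L)) : Matrix (Fin 3) (Fin 3) (w.1.adicCompletion L)) := by
      rw [← map_inv, hcoeinv, map_mul, map_mul,
        map_inv (Units.map (RingHom.mapMatrix (Pi.evalRingHom (fun w' : PlacesOver L v => w'.1.adicCompletion L) w)).toMonoidHom :
          GL (Fin 3) (LocalRing L v) →* GL (Fin 3) (w.1.adicCompletion L)) (x : GL (Fin 3) (LocalRing L v)),
        Units.val_mul, Units.val_mul, coe_unitsMap_eval_glDiagonal]
      rfl
    set x' : GL (Fin 3) (w.1.adicCompletion L) :=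
      Units.map (RingHom.mapMatrix (Pi.evalRingHom (fun w' : PlacesOver L v => w'.1.adicCompletion L) w)).toMonoidHom (x : GL (Fin 3) (LocalRing L v)) with hx'
    set g : GL (Fin 3) (w.1.adicCompletion L) :=
      Units.map (RingHom.mapMatrix (Pi.evalRingHom (fun w' : PlacesOver L v => w'.1.adicCompletion L) w)).toMonoidHom
        (((x * (t : ↥(unitaryGroupOfForm (conjLocal L (IsCMField.complexConj L) v) (cmLocalForm L 3 v))) * x⁻¹ : ↥(unitaryGroupOfForm (conjLocal L (IsCMField.complexConj L) v) (cmLocalForm L 3 v)))) : GL (Fin 3) (LocalRing L v)) with hgdef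
    have hsum1 : (∑ k, ∑ j, ‖(g : Matrix (Fin 3) (Fin 3) (w.1.adicCompletion L)) k j‖) ≤ ∑ w, R w :=
      (Finset.sum_le_sum fun k _ => Finset.sum_le_sum fun j _ => le_add_of_nonneg_right (norm_nonneg _)).trans hB
    have hsum2 : (∑ k, ∑ j, ‖((g⁻¹ : GL (Fin 3) (w.1.adicCompletion L)) : Matrix (Fin 3) (Fin 3) (w.1.adicCompletion L)) k j‖) ≤ ∑ w, R w :=
      (Finset.sum_le_sum fun k _ => Finset.sum_le_sum fun j _ => le_add_of_nonneg_left (norm_nonneg _)).trans hB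
    constructor
    · have h1 := norm_le_sum_norm_of_mulVec_eq_smul _ (mulVec_single_ne_zero x' 0)
        (conj_diagonal_mulVec_eq_smul x' (fun i => ((d i : (LocalRing L v)ˣ) : LocalRing L v) w) 0)
      rw [← hval] at h1
      exact h1.trans hsum1
    · have h2 := norm_le_sum_norm_of_mulVec_eq_smul _ (mulVec_single_ne_zero x' 0)
        (conj_diagonal_mulVec_eq_smul x' (fun i => (((d i)⁻¹ : (LocalRing L v)ˣ) : LocalRing L v) w) 0)
      rw [← hvalinv] at h2
      exact h2.trans hsum2
  -- conclude through the chart: `t = ι (t₀₀, det t)` with `t₀₀ = d 0` in the compact box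
  refine ⟨F0P3cStCharTSTorusChartIso.torusCoords L v t, ⟨?_, Set.mem_univ _⟩, F0P3cStCharTSTorusChartIso.torusChart_torusCoords L v t⟩
  have hc0 : (F0P3cStCharTSTorusChartIso.torusCoords L v t).1 = d 0 := torusEntry_eq_of_glDiagonal_eq _ _ 0 t d hd
  rw [Set.mem_setOf_eq, hc0]
  exact ⟨(pi_norm_le_iff_of_nonneg hRs0).2 fun w => (hbd w).1, (pi_norm_le_iff_of_nonneg hRs0).2 fun w => (hbd w).2⟩

include hns in
/-- **The conjugate-torus form**: for `T′ = y M y⁻¹` (every SPLIT Cartan `Z_G(γ)` is of this shape) and a compact `C ⊆ G`, the elements of `T′` with a conjugate in `C` lie in a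
compact subset of `G` contained in `T′`. [cite: HarishChandra1970, Lemma 42] [cite: Rogawski1990, §12.5 p. 183] -/
theorem exists_isCompact_forall_conj_mem_conj_cmBorelM {C : Set ↥(unitaryGroupOfForm (conjLocal L (IsCMField.complexConj L) v) (cmLocalForm L 3 v))} (hC : IsCompact C) (y : ↥(unitaryGroupOfForm (conjLocal L (IsCMField.complexConj L) v) (cmLocalForm L 3 v))) :
    ∃ K : Set ↥(unitaryGroupOfForm (conjLocal L (IsCMField.complexConj L) v) (cmLocalForm L 3 v)), IsCompact K ∧ (∀ g ∈ K, y⁻¹ * g * y ∈ (cmBorelTriple L 3 v).M) ∧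
      ∀ g : ↥(unitaryGroupOfForm (conjLocal L (IsCMField.complexConj L) v) (cmLocalForm L 3 v)), y⁻¹ * g * y ∈ (cmBorelTriple L 3 v).M → (∃ x : ↥(unitaryGroupOfForm (conjLocal L (IsCMField.complexConj L) v) (cmLocalForm L 3 v)), x * g * x⁻¹ ∈ C) → g ∈ K := by
  obtain ⟨K, hK, hmem⟩ := exists_isCompact_forall_conj_mem_cmBorelM L v hns hC
  refine ⟨(fun t : ↥(cmBorelTriple L 3 v).M => y * (t : ↥(unitaryGroupOfForm (conjLocal L (IsCMField.complexConj L) v) (cmLocalForm L 3 v))) * y⁻¹) '' K,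
    hK.image ((continuous_const.mul continuous_subtype_val).mul continuous_const), ?_, ?_⟩
  · rintro g ⟨t, -, rfl⟩
    have : y⁻¹ * (y * (t : ↥(unitaryGroupOfForm (conjLocal L (IsCMField.complexConj L) v) (cmLocalForm L 3 v))) * y⁻¹) * y = (t : ↥(unitaryGroupOfForm (conjLocal L (IsCMField.complexConj L) v) (cmLocalForm L 3 v))) := by group
    rw [this]; exact t.2
  · rintro g hg ⟨x, hx⟩
    refine ⟨⟨y⁻¹ * g * y, hg⟩, hmem ⟨y⁻¹ * g * y, hg⟩ ⟨x * y, ?_⟩, by simp only; group⟩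
    have : x * y * (y⁻¹ * g * y) * (x * y)⁻¹ = x * g * x⁻¹ := by group
    rw [this]; exact hx

include hns in
/-- **(A0-iv) AT ANY CARTAN `Z_G(γ)`** (`γ` regular; the shape (A-3) ∕ (A1′) FILE E read at `T′ = Z_G(ψ γ₀)`): for every compact `C ⊆ G` there is a compact `K ⊆ ↥Z_G(γ)` containing every
`t ∈ Z_G(γ)` with a `G`-conjugate in `C`.  Dichotomy ★ `exists_conj_cmTorus_of_not_isCompact_centralizer`: either `Z_G(γ)` is compact (`K := univ`), or `Z_G(γ) = x M x⁻¹` and the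
conjugate-torus form applies (`Z_G(γ)` is closed, so the preimage of a compact set of `G` is compact in `↥Z_G(γ)`). [cite: HarishChandra1970, Lemma 42] [cite: Rogawski1990, §3.6 pp. 28–31; §12.5 p. 183] -/
theorem exists_isCompact_forall_conj_mem_centralizer (γ : ↥(unitaryGroupOfForm (conjLocal L (IsCMField.complexConj L) v) (cmLocalForm L 3 v))) (hγ : IsRegularElt ((γ : GL (Fin 3) (LocalRing L v)))) (C : Set ↥(unitaryGroupOfForm (conjLocal L (IsCMField.complexConj L) v) (cmLocalForm L 3 v))) (hC : IsCompact C) :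
    ∃ K : Set ↥(Subgroup.centralizer ({γ} : Set ↥(unitaryGroupOfForm (conjLocal L (IsCMField.complexConj L) v) (cmLocalForm L 3 v)))), IsCompact K ∧
      ∀ t : ↥(Subgroup.centralizer ({γ} : Set ↥(unitaryGroupOfForm (conjLocal L (IsCMField.complexConj L) v) (cmLocalForm L 3 v)))), (∃ x : ↥(unitaryGroupOfForm (conjLocal L (IsCMField.complexConj L) v) (cmLocalForm L 3 v)), x * (t : ↥(unitaryGroupOfForm (conjLocal L (IsCMField.complexConj L) v) (cmLocalForm L 3 v))) * x⁻¹ ∈ C) → t ∈ K := by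
  by_cases hcpt : IsCompact ((Subgroup.centralizer ({γ} : Set ↥(unitaryGroupOfForm (conjLocal L (IsCMField.complexConj L) v) (cmLocalForm L 3 v))) : Subgroup ↥(unitaryGroupOfForm (conjLocal L (IsCMField.complexConj L) v) (cmLocalForm L 3 v))) : Set ↥(unitaryGroupOfForm (conjLocal L (IsCMField.complexConj L) v) (cmLocalForm L 3 v)))
  · exact ⟨Set.univ, isCompact_iff_isCompact_univ.1 hcpt, fun t _ => Set.mem_univ t⟩
  · obtain ⟨x, -, -, -, hZ⟩ := F0P3cStCharTSEllCartanCompact.exists_conj_cmTorus_of_not_isCompact_centralizer L v hns hγ hcpt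
    obtain ⟨K, hK, -, hmem⟩ := exists_isCompact_forall_conj_mem_conj_cmBorelM L v hns hC x
    have hcl : IsClosed ((Subgroup.centralizer ({γ} : Set ↥(unitaryGroupOfForm (conjLocal L (IsCMField.complexConj L) v) (cmLocalForm L 3 v))) : Subgroup ↥(unitaryGroupOfForm (conjLocal L (IsCMField.complexConj L) v) (cmLocalForm L 3 v))) : Set ↥(unitaryGroupOfForm (conjLocal L (IsCMField.complexConj L) v) (cmLocalForm L 3 v))) := Set.isClosed_centralizer _
    exact ⟨Subtype.val ⁻¹' K, hcl.isClosedEmbedding_subtypeVal.isCompact_preimage hK, fun t ht => hmem (t : ↥(unitaryGroupOfForm (conjLocal L (IsCMField.complexConj L) v) (cmLocalForm L 3 v))) ((hZ (t : ↥(unitaryGroupOfForm (conjLocal L (IsCMField.complexConj L) v) (cmLocalForm L 3 v)))).1 t.2) ht⟩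

end CM

end Summit.HodgeConjecture.HodgeConjecture.Cruxes.H413.F0P3cStCharTSUpTrSupportCompact

end
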